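import Summits.ResolutionOfSingularities.ResolutionOfSingularities.Theorems.DeltaCutStellarStrategy

/-!
# StellarCut T9 — «StrategyAbstract»: the terminating face strategy of `DeltaCutStellarStrategy` (T5) over an ABSTRACT
# FACE-STABLE SHAPE (lens-6, g32 → g33 tool; 0-weight)

`DeltaCutStellarStrategy.exists_weakResolution_of_starBelowH` runs Kollár's phase-by-phase measure `(m_r^H, n_r^H)`
((3.111) Step 3, relativised to the contact hypersurface `H`) on marked ideals of the IDEAL SHAPE `𝓘 = Hⁿ + Π K_j^{a_j}`.
The induction touches the shape in exactly THREE places: (a) the ROUND lemma `ncShape_round` (after the blow-up of a face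
`H ∩ ⋂_{j∈T} K_j` of weight `≥ n` the transform has the shape again, for the transported frame `H' :: transformExp E π T n`);
(b) the FACE lemma `support_finsetSup_subset_support_ncShape` (such a face lies in the support — first clause of weak
admissibility); (c) the TERMINAL lemma `support_ncShape_eq_empty` (if every point of `V(H)` has weight `< n` the support is
empty).  The persistence of simple normal crossings (`hasSNC_ncShape_transform`) and the whole measure bookkeeping are
shape-independent.

THIS FILE abstracts (a)–(c) into the predicate-level structure `FaceStableShape n P` for an arbitrary shape
`P X E H M : Prop` (scheme, labelled boundary, contact member, marked ideal) and proves the strategy theorem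
`FaceStableShape.exists_weakResolution` (+ the phase form `FaceStableShape.exists_weakResolution_of_starBelowH`) for every
such `P`; the ideal shape is recovered as the instance `faceStableShape_ncIdealShape`, with T5's theorem re-derived
(the closing `example`, ex `exists_weakResolution_ncShape'`).  PURPOSE: the hypersurface-shape cells of `DeltaCutStellarTame` (T8) — for `p ∤ n` the shape
`IsNCHypStage`-data is face-stable by the first-order derivation guard, and its law `worNCHypTame_holds` then needs only the
three shape lemmas, not a second copy of the induction.  0 sorry; axioms standard. [new] [folklore]
[cite: Kollar2007, (3.111) Step 3] [cite: BierstoneGrigorievMilmanWlodarczyk2011, Def. 3.1.3]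
-/

noncomputable section

open CategoryTheory CategoryTheory.Limits AlgebraicGeometry TopologicalSpace IsLocalRing
open Literature.AlgebraicGeometry.Resolution

namespace Summit.ResolutionOfSingularities.ResolutionOfSingularities.Theorems.DeltaCutClasses

section StrategyAbstract

open Summit.ResolutionOfSingularities.ResolutionOfSingularities.Theorems.WeakOrderReduction

/-- **A SHAPE of marked ideals relative to a labelled frame with a contact member** — a predicate on
(scheme, labelled boundary `E`, contact member `H`, marked ideal `M`), uniformly in the (universe-`0`) scheme. -/
abbrev Shape : Type 1 :=
  ∀ (X : Scheme.{0}), List (X.IdealSheafData × ℕ) → X.IdealSheafData → MarkedIdeal X → Prop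

/-- **`FaceStableShape n P` — the three shape lemmas the face strategy consumes at marking `n`**:
`round` — after the blow-up of a face `⨆ T`, `H ∈ T ⊆ H :: E`, of weight `≥ n` (frame `H :: E` s.n.c.) the transform of a
`P`-datum is a `P`-datum for the transported frame `(strict transform of H) :: transformExp E π T n`;
`face` — such a face lies in the support of a `P`-datum;
`terminal` — a `P`-datum every point of `V(H)` of which has boundary weight `< n` has empty support.
(For the ideal shape `Hⁿ + Π K_j^{a_j}`: `ncShape_round`, `support_finsetSup_subset_support_ncShape`,
`support_ncShape_eq_empty` — instance `faceStableShape_ncIdealShape`.) -/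
structure FaceStableShape (n : ℕ) (P : Shape) : Prop where
  /-- the shape survives a face round through `H` of weight `≥ n`, for the transported frame -/
  round : ∀ (X : Scheme.{0}) [IsLocallyNoetherian X] (E : List (X.IdealSheafData × ℕ)) (H : X.IdealSheafData)
    (T : Finset X.IdealSheafData) (M : MarkedIdeal X), HasSNC (H :: boundaryOf E) → (∀ K ∈ T, K ∈ H :: boundaryOf E) →
    H ∈ T → n ≤ weightOf E T → P X E H M →
      P (blowup (T.sup id)) (transformExp E (blowup.π (T.sup id)) T n)
        (strictTransformIdeal (blowup.π (T.sup id)) (T.sup id) H) (M.transform (blowup.π (T.sup id)) (T.sup id))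
  /-- a face through `H` of weight `≥ n` lies in the support -/
  face : ∀ (X : Scheme.{0}) [IsLocallyNoetherian X] (E : List (X.IdealSheafData × ℕ)) (H : X.IdealSheafData)
    (T : Finset X.IdealSheafData) (M : MarkedIdeal X), HasSNC (H :: boundaryOf E) → H ∈ T → n ≤ weightOf E T →
    P X E H M → ((T.sup id).support : Set X) ⊆ M.support
  /-- if every point of `V(H)` has boundary weight `< n`, the support is empty -/
  terminal : ∀ (X : Scheme.{0}) [IsLocallyNoetherian X] (E : List (X.IdealSheafData × ℕ)) (H : X.IdealSheafData)
    (M : MarkedIdeal X), HasSNC (H :: boundaryOf E) → H ∈ boundaryOf E → P X E H M →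
    (∀ x ∈ H.support, weightAt E x < n) → M.support = ∅

namespace FaceStableShape

variable {n : ℕ} {P : Shape}

/-- **ONE ROUND, resolution** (abstract `weakResolution_cons_face`): if the rest weakly resolves the transform of a `P`-datum
under the blow-up of a face through `H` of weight `≥ n`, the whole sequence weakly resolves it. -/
theorem weakResolution_cons (S : FaceStableShape n P) {X : Scheme.{0}} [IsLocallyNoetherian X]
    {E : List (X.IdealSheafData × ℕ)} {H : X.IdealSheafData} {T : Finset X.IdealSheafData}
    (hEs : HasSNC (H :: boundaryOf E)) (hT : ∀ K ∈ T, K ∈ H :: boundaryOf E) (hHT : H ∈ T) (hn : n ≤ weightOf E T)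
    (M : MarkedIdeal X) (hP : P X E H M) {rest : CentreSeq (blowup (T.sup id))}
    (hrest : WeakResolution rest (M.transform (blowup.π (T.sup id)) (T.sup id))) :
    WeakResolution (.cons (T.sup id) rest) M :=
  ⟨⟨S.face X E H T M hEs hHT hn hP, hEs.isRegular_subscheme_finsetSup T hT, hrest.1⟩, hrest.2⟩

/-- **"At the end of phase `N` we are done"** (abstract `support_eq_empty_of_starBelowH`). -/
theorem support_eq_empty_of_starBelowH (S : FaceStableShape n P) {X : Scheme.{0}} [IsLocallyNoetherian X]
    {E : List (X.IdealSheafData × ℕ)} {H : X.IdealSheafData} (hEs : HasSNC (H :: boundaryOf E))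
    (hH : H ∈ boundaryOf E) {N : ℕ} (hN : ∀ x, (divThrough E x).card ≤ N) (h : StarBelowH E H n (N + 1))
    (M : MarkedIdeal X) (hP : P X E H M) : M.support = ∅ := by
  refine S.terminal X E H M hEs hH hP fun x hx => ?_
  rw [weightAt_eq_weightOf_divThrough]
  exact h (divThrough E x).card (Nat.lt_succ_of_le (hN x)) _ (divThrough_mem_incSubsets E x)
    (mem_divThrough_iff.mpr ⟨hH, hx⟩)

/-- **THE FACE STRATEGY, PHASE BY PHASE, FOR AN ABSTRACT FACE-STABLE SHAPE** (`P(r)`: every `P`-datum with `H :: E`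
s.n.c., `H ∈ E`, at most `N` divisors through any point, and `(*_s)^H` for all `s < r`, has a weak resolution): downward
induction on `r ≤ N + 1`, and within phase `r` a lexicographic induction on `(m_r^H, n_r^H)`, the step being the blow-up of
the face of an `r`-set `T ∋ H` of maximal weight `≥ n` — VERBATIM the induction of
`DeltaCutClasses.exists_weakResolution_of_starBelowH` with the three shape lemmas abstracted. [cite: Kollar2007, (3.111) Step 3] -/
theorem exists_weakResolution_of_starBelowH (S : FaceStableShape n P) (N : ℕ) :
    ∀ (d r : ℕ), r + d = N + 1 → ∀ (W c : ℕ) (X : Scheme.{0}) [IsLocallyNoetherian X]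
      (E : List (X.IdealSheafData × ℕ)) (H : X.IdealSheafData), HasSNC (H :: boundaryOf E) →
      H ∈ boundaryOf E → (∀ x, (divThrough E x).card ≤ N) → StarBelowH E H n r →
      maxWeightH E H r = W → numMaxH E H r = c → ∀ M : MarkedIdeal X,
      P X E H M → ∃ s : CentreSeq X, WeakResolution s M := by
  classical
  intro d
  induction d with
  | zero =>
    intro r hr W c X _ E H hEs hH hN hstar _ _ M hP
    refine ⟨CentreSeq.nil X, weakResolution_nil_of_support_eq_empty M ?_⟩
    rw [Nat.add_zero] at hr
    exact S.support_eq_empty_of_starBelowH hEs hH hN (hr ▸ hstar) M hP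
  | succ d ihd =>
    -- lexicographic induction on `(W, c) = (m_r^H, n_r^H)`
    intro r hr W
    induction W using Nat.strong_induction_on with
    | _ W ihW =>
    intro c
    induction c using Nat.strong_induction_on with
    | _ c ihc =>
    intro X _ E H hEs hH hN hstar hW hc M hP
    by_cases hnext : ∀ T ∈ incSubsetsH E H r, weightOf E T < n
    · -- no `r`-set through `H` reaches `n`: `(*_r)^H` holds, pass to phase `r + 1`
      exact ihd (r + 1) (by omega) _ _ X E H hEs hH hN (hstar.succ hnext) rfl rfl M hP
    · -- blow up the face of an `r`-set through `H` of maximal weight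
      push Not at hnext
      obtain ⟨T₀, hT₀, hmT₀⟩ := hnext
      obtain ⟨T, hTrH, hTmax⟩ := Finset.exists_mem_eq_sup (incSubsetsH E H r) ⟨T₀, hT₀⟩ (weightOf E)
      have hTmax' : weightOf E T = maxWeightH E H r := hTmax.symm
      have hmT : n ≤ weightOf E T := hmT₀.trans (hTmax ▸ weightOf_le_maxWeightH hT₀)
      obtain ⟨hTr, hHT⟩ := mem_incSubsetsH_iff.mp hTrH
      have hE : HasSNC (boundaryOf E) := hasSNC_boundaryOf_of_cons hEs
      have hT : ∀ K ∈ T, K ∈ boundaryOf E := fun K hK =>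
        mem_sheaves_iff.mp ((mem_incSubsets_iff.mp hTr).1 hK)
      have hT' : ∀ K ∈ T, K ∈ H :: boundaryOf E := fun K hK => List.mem_cons_of_mem _ (hT K hK)
      set C : X.IdealSheafData := T.sup id with hC
      haveI : IsLocallyNoetherian (blowup C) := CentreSeq.isLocallyNoetherian_blowup C
      have hπ : IsBlowup (blowup.π C) (T.sup id) := blowup.isBlowup C
      set E' := transformExp E (blowup.π C) T n with hE'
      set H' := strictTransformIdeal (blowup.π C) (T.sup id) H with hH'def
      -- the transformed data
      have hP' : P (blowup C) E' H' (M.transform (blowup.π C) C) := S.round X E H T M hEs hT' hHT hmT hP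
      have hEs' : HasSNC (H' :: boundaryOf E') := hasSNC_ncShape_transform hEs hT' hπ n
      have hH' : H' ∈ boundaryOf E' := strictTransform_mem_boundaryOf_transformExp hH n
      have hN' : ∀ x', (divThrough E' x').card ≤ N := fun x' =>
        (card_divThrough_transformExp_le hE hT hπ x').trans (hN _)
      have hstar' : StarBelowH E' H' n r := starBelowH_transformExp hE hH hT hHT hπ hTr hmT hstar
      have hle : maxWeightH E' H' r ≤ W :=
        hW ▸ maxWeightH_transformExp_le hE hH hT hπ hTr hTmax' hmT hstar
      -- the induction hypothesis applies to the transform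
      obtain ⟨s', hs'⟩ : ∃ s' : CentreSeq (blowup C), WeakResolution s' (M.transform (blowup.π C) C) := by
        rcases hle.lt_or_eq with hlt | heq
        · exact ihW _ hlt _ (blowup C) E' H' hEs' hH' hN' hstar' rfl rfl _ hP'
        · have hlt : numMaxH E' H' r < c :=
            hc ▸ numMaxH_transformExp_lt hE hH hT hHT hπ hTr hTmax' hmT hstar (heq.trans hW.symm)
          exact ihc _ hlt (blowup C) E' H' hEs' hH' hN' hstar' heq rfl _ hP'
      -- prepend the blow-up of the face `C`
      exact ⟨CentreSeq.cons C s', S.weakResolution_cons hEs hT' hHT hmT M hP hs'⟩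

/-- ★ **WEAK ORDER REDUCTION FOR ANY FACE-STABLE SHAPE by the terminating face strategy**: on a locally Noetherian scheme, a
`P`-datum for a labelled boundary `E` containing `H` with `H :: E` s.n.c. admits a `WeakResolution` (blow-ups of the faces
`H ∩ ⋂_{j∈S} K_j` of maximal weight `≥ n` in Kollár's phases relativised to `H`, until the support is empty). -/
theorem exists_weakResolution (S : FaceStableShape n P) {X : Scheme.{0}} [IsLocallyNoetherian X]
    {E : List (X.IdealSheafData × ℕ)} {H : X.IdealSheafData} (hEs : HasSNC (H :: boundaryOf E)) (hH : H ∈ boundaryOf E)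
    (M : MarkedIdeal X) (hP : P X E H M) : ∃ s : CentreSeq X, WeakResolution s M := by
  classical
  set N := (sheaves E).card with hN
  have hbound : ∀ x, (divThrough E x).card ≤ N := fun x =>
    Finset.card_le_card fun K hK => mem_sheaves_iff.mpr (mem_divThrough_iff.mp hK).1
  exact S.exists_weakResolution_of_starBelowH N (N + 1) 0 (by omega) _ _ X E H hEs hH hbound
    (fun s hs => absurd hs (Nat.not_lt_zero s)) rfl rfl M hP

end FaceStableShape

/-- **THE N.C. IDEAL SHAPE `Hⁿ + Π K_j^{a_j}` at marking `n`** as a `Shape`. -/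
def ncIdealShape (n : ℕ) : Shape := fun _ E H M => M.ideal = H ^ n + monomialIdeal E ∧ M.mult = n

/-- the n.c. ideal shape is FACE-STABLE at every marking `n ≥ 1` (`ncShape_round`, `support_finsetSup_subset_support_ncShape`,
`support_ncShape_eq_empty` of `DeltaCutStellarTransform`). [folklore] -/
theorem faceStableShape_ncIdealShape {n : ℕ} (hn : 1 ≤ n) : FaceStableShape n (ncIdealShape n) where
  round _ _ _ _ _ M hEs hT hHT hmT hP :=
    ⟨(ncShape_round hEs hT hHT hmT M hP.1 hP.2).1, (ncShape_round hEs hT hHT hmT M hP.1 hP.2).2.1⟩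
  face _ _ _ _ _ M hEs hHT hmT hP := support_finsetSup_subset_support_ncShape hEs hHT hn hmT M hP.1 hP.2
  terminal _ _ _ _ M hEs _ hP h := support_ncShape_eq_empty (hasSNC_boundaryOf_of_cons hEs) hn M hP.1 hP.2 h

-- WRITER NOTE (decomp-res writer-1 g15): the lens's `theorem exists_weakResolution_ncShape'` restates the landed
-- `exists_weakResolution_ncShape` of `DeltaCutStellarStrategy` verbatim (gate `dedup.landed` at pre-flight), so the
-- consistency check is kept as an `example` (same statement and proof, no new declaration).
-- T5's `exists_weakResolution_ncShape` RE-DERIVED from the abstract strategy (consistency check of the abstraction). [folklore]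
example {X : Scheme.{0}} [IsLocallyNoetherian X] {E : List (X.IdealSheafData × ℕ)}
    {H : X.IdealSheafData} (hEs : HasSNC (H :: boundaryOf E)) (hH : H ∈ boundaryOf E) {n : ℕ} (hn : 1 ≤ n)
    (M : MarkedIdeal X) (hI : M.ideal = H ^ n + monomialIdeal E) (hμ : M.mult = n) :
    ∃ s : CentreSeq X, WeakResolution s M :=
  (faceStableShape_ncIdealShape hn).exists_weakResolution hEs hH M ⟨hI, hμ⟩

end StrategyAbstract

end Summit.ResolutionOfSingularities.ResolutionOfSingularities.Theorems.DeltaCutClasses
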